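import Literature.AlgebraicGeometry.Resolution.ProperModelsPatchingOfResolution
import Literature.AlgebraicGeometry.Resolution.ResolutionLU
import Mathlib.FieldTheory.PurelyInseparable.Basic
import HarnessLib

/-!
# Stub `stub_atoms_of_perfectRes` (crux stmt-ResolutionOfSingularities-0552, line `Sketch` rev. c3)

Glue stub of the skeleton `Sketch` (rev. c3) for the crux `PalterationThesis`
(stmt-ResolutionOfSingularities-0552): **the reshape loses nothing — resolution over `K` returns
the three atoms over `K`.** Over ONE field `K` of characteristic `p` (no perfectness needed),
resolution of every reduced separated `K`-scheme of finite type (`hres`) gives back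

* (T) Temkin's conclusion over `K` with `L := F` itself: a resolution of an affine model of a
  valuation ring `O ∋ K` of a finitely generated `F/K` uniformizes `O`
  (`exists_affineModel`, `exists_affineModel_regular_of_hasResolution`, as in
  `ResolutionInChar.localUniformizationInChar`);
* (R) RRLU1 over `K`: under `hres` EVERY valuation ring over `K` of a finitely generated `F/K` is
  locally uniformizable, in particular `O ∩ F` for `O ⊇ B ∋ K` a valuation ring of `L ⊇ F`
  (as in `rrLU1_of_localUniformizationInChar`);
* (Z) two-model patching of proper models over `K`: resolve the join of the two models
  (`ProperModel.join`, `ProperModel.exists_hom_isRegular_of_hasResolution`, as in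
  `ProperModel.twoModelPatching_of_resolutionInChar`); a regular model is `RegLe` over both.
-/

set_option linter.dupNamespace false

noncomputable section

open CategoryTheory AlgebraicGeometry IsLocalRing
open Literature.AlgebraicGeometry.Resolution

namespace Summit.ResolutionOfSingularities.ResolutionOfSingularities.Theorems.PalterationThesis.PerfectAtoms

/-- Under resolution of every reduced separated `K`-scheme of finite type, `Spec R` has a
resolution for every reduced finitely generated `K`-algebra `R` (the structure morphism
`Spec R → Spec K` is affine, hence separated and quasi-compact, and locally of finite type).
[folklore] -/
theorem hasResolution_spec_of_resOver {K : Type} [Field K]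
    (hres : ∀ (X : Scheme.{0}) (f : X ⟶ Spec (.of K)),
      IsSeparated f → LocallyOfFiniteType f → QuasiCompact f → IsReduced X →
      Scheme.HasResolution X)
    (R : Type) [CommRing R] [_root_.IsReduced R] [Algebra K R] [Algebra.FiniteType K R] :
    Scheme.HasResolution (Spec (.of R)) := by
  -- adapted from `ResolutionInChar.hasResolution_spec` (ResolutionLU.lean)
  let f : Spec (.of R) ⟶ Spec (.of K) := Spec.map (CommRingCat.ofHom (algebraMap K R))
  haveI : LocallyOfFiniteType f :=
    (HasRingHomProperty.Spec_iff (P := @LocallyOfFiniteType)).mpr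
      (RingHom.finiteType_algebraMap.mpr ‹_›)
  exact hres (Spec (.of R)) f inferInstance inferInstance inferInstance inferInstance

/-- **Resolution over `K` implies local uniformization over `K`**: under resolution of every
reduced separated `K`-scheme of finite type, every valuation ring `O ∋ K` of a finitely generated
extension `F/K` is locally uniformizable over `K` (take an affine model `A ⊆ O` of `F/K` and
resolve `Spec A`; the valuative criterion centres `O` at a regular point of the resolution).
[folklore] -/
theorem isLocallyUniformizable_of_resOver {K : Type} [Field K]
    (hres : ∀ (X : Scheme.{0}) (f : X ⟶ Spec (.of K)),
      IsSeparated f → LocallyOfFiniteType f → QuasiCompact f → IsReduced X →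
      Scheme.HasResolution X)
    (F : Type) [Field F] [Algebra K F] (hFfg : (⊤ : IntermediateField K F).FG)
    (O : ValuationSubring F) (hO : ∀ c : K, algebraMap K F c ∈ O) :
    IsLocallyUniformizable K F O := by
  -- adapted from `ResolutionInChar.localUniformizationInChar` (ResolutionLU.lean)
  obtain ⟨A, hAO, hfg, hfr⟩ := exists_affineModel K F hFfg O hO
  haveI : Algebra.FiniteType K A := A.fg_iff_finiteType.mp hfg
  obtain ⟨A', h', hle, hfg', hreg⟩ :=
    exists_affineModel_regular_of_hasResolution O A hAO hfg hfr
      (hasResolution_spec_of_resOver hres A)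
  exact ⟨A', h', hfg', isFractionRing_of_le hle hfr, hreg⟩

/-- **GLUE STUB `stub_atoms_of_perfectRes` (worker B; the reshape loses nothing).** Over a field
`K` of characteristic `p`, resolution of every reduced separated `K`-scheme of finite type gives
back the three atoms over `K`: Temkin's conclusion with `L = F` (a resolution of an affine model
uniformizes every valuation ring dominating it, `isLocallyUniformizable_of_resOver`), RRLU1 over
`K` (uniformize `O ∩ F` outright), and two-model patching over `K` (resolve the join of the two
models, `ProperModel.exists_hom_isRegular_of_hasResolution`; a regular model is `RegLe` over
every model it dominates). [folklore] -/
theorem stub_atoms_of_perfectRes (p : ℕ) (hp : p.Prime) (K : Type) [Field K] [CharP K p]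
    (hres : ∀ (X : Scheme.{0}) (f : X ⟶ Spec (.of K)),
      IsSeparated f → LocallyOfFiniteType f → QuasiCompact f → IsReduced X →
      Scheme.HasResolution X) :
    (∀ (F : Type) [Field F] [Algebra K F], (⊤ : IntermediateField K F).FG →
      ∀ O : ValuationSubring F, (∀ c : K, algebraMap K F c ∈ O) →
        ∃ (L : Type) (_ : Field L) (_ : Algebra F L) (_ : Algebra K L) (_ : IsScalarTower K F L),
          FiniteDimensional F L ∧ IsPurelyInseparable F L ∧
          ∃ O' : ValuationSubring L, O'.comap (algebraMap F L) = O ∧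
            IsLocallyUniformizable K L O') ∧
    (∀ (F L : Type) [Field F] [Field L] [Algebra K F] [Algebra F L] [Algebra K L]
      [IsScalarTower K F L], (⊤ : IntermediateField K F).FG → IsPurelyInseparable F L →
      (∃ y : L, y ^ p ∈ (algebraMap F L).range ∧ IntermediateField.adjoin F {y} = ⊤) →
      ∀ B : Subalgebra K L, B.FG → IsFractionRing B L → IsRegularRing B →
      ∀ O : ValuationSubring L, B.toSubring ≤ O.toSubring →
        IsLocallyUniformizable K F (O.comap (algebraMap F L))) ∧
    (∀ (F : Type) [Field F] [Algebra K F] [Algebra.EssFiniteType K F],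
      ∀ M₁ M₂ : ProperModel K F,
        ∃ (N : ProperModel K F) (φ₁ : N.Hom M₁) (φ₂ : N.Hom M₂), φ₁.RegLe ∧ φ₂.RegLe) := by
  have _ : Fact p.Prime := ⟨hp⟩ -- registered hypothesis; the bookkeeping does not need primality
  refine ⟨fun F _ _ hFfg O hO => ?_, ?_, fun F _ _ _ M₁ M₂ => ?_⟩
  · -- (T): `L := F`, `O' := O` (adapted from `LocalUniformizationInChar.self`)
    refine ⟨F, inferInstance, inferInstance, inferInstance, inferInstance, inferInstance,
      inferInstance, O, ?_, isLocallyUniformizable_of_resOver hres F hFfg O hO⟩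
    ext x
    simp
  · -- (R): uniformize `O ∩ F` outright (adapted from `rrLU1_of_localUniformizationInChar`,
    -- PAlterationPialtSqueezeRRLU1.lean)
    intro F L _ _ _ _ _ _ hFfg _hpi _hy B _hBfg _hBfr _hBreg O hBO
    refine isLocallyUniformizable_of_resOver hres F hFfg (O.comap (algebraMap F L)) fun c => ?_
    change algebraMap F L (algebraMap K F c) ∈ O
    rw [← IsScalarTower.algebraMap_apply]
    exact hBO (B.algebraMap_mem c)
  · -- (Z): resolve the join (adapted from `ProperModel.twoModelPatching_of_resolutionInChar`,
    -- ProperModelsPatchingOfResolution.lean)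
    obtain ⟨N, φ, hN⟩ := (ProperModel.join M₁ M₂).exists_hom_isRegular_of_hasResolution
      (hres _ (ProperModel.join M₁ M₂).π inferInstance inferInstance inferInstance inferInstance)
    exact ⟨N, φ.comp (ProperModel.joinFst M₁ M₂), φ.comp (ProperModel.joinSnd M₁ M₂),
      fun y _ => hN y, fun y _ => hN y⟩

end Summit.ResolutionOfSingularities.ResolutionOfSingularities.Theorems.PalterationThesis.PerfectAtoms

end
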